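import Summits.ABC.IUTFork.Thm311RealInd1StripTwistMoverOdd
import HarnessLib

/-!
# [IUTchIII] Thm 3.11 (i) (Ind1) at `v ∈ 𝕍^non`, all-planes obstruction — WINDOWED and OUTWARD form: in EVERY window of
# `e + 1` consecutive balls `𝔪_v^k ⊋ ⋯ ⊋ 𝔪_v^{k+e}` some ball has a point carried OUT of it by a realised twist

PROOF-ONLY file (abc-iut cell, Cor. 3.12 sub-crew, seat abc-iut-c312-1 = holder of record of the typed [IUTchIII] Thm. 3.11,
gen 10; row «R11 IND1-STRIP-MOVER-ALL-PLANES», part d).  TAKES NO SIDE on [IUTchIII] Cor. 3.12.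

`Thm311RealInd1StripTwistMoverOdd` (p479901) concludes «SOME ball `ϖ^m 𝒪` is not mapped onto itself».  The same count, run on
the chain `B_k ⊋ B_{k+1} ⊋ ⋯ ⊋ B_{k+e}` for an ARBITRARY `k ∈ ℤ` (the plane coefficient balls of `B_k` and `B_{k+e}` in `ℚ_p`
still differ by the factor `‖p‖` exactly, `relIndex_ball_padic`), gives the sharper, consumer-shaped statements:

* §1 **`not_forall_twistStable_piBall_window_of_odd`** — (`f` odd, `[K : ℚ_p] < e + 2·#ι`, Kronecker twist family) for every
  `k ∈ ℤ`, NOT all of the `e + 1` balls `B_m`, `k ≤ m ≤ k + e`, are stable under all the `2·#ι` transvections;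
* §2 **`exists_transvection_mapsOut_piBall_of_odd`** — hence in every such window there are a ball `B_m`, a plane `i` and a
  point `v ∈ B_m` with `v + cb i v • ya i ∉ B_m` or `v − ca i v • yb i ∉ B_m`: a point of `B_m` is carried OUT of `B_m`
  (strict inflation of the twist-hull of `B_m`, not merely `T(B_m) ≠ B_m`);
* §3 **AT THE REAL LOG-SHELL**: `Real.exists_mem_ind1StripOf_mapsOut_closedBall_of_planes` — with the realisation BINDERS of
  `Real.exists_mem_ind1StripOf_image_closedBall_ne_of_planes` (elements `ψ i, ψ' i` of print's (Ind1) strip part acting as the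
  twist pairs), for every `k ∈ ℤ` some `χ ∈ Real.ind1StripOf v L`, some `m` with `k ≤ m ≤ k + e(v|p)` and some `x ∈ 𝔪_v^m`
  (`= B(0,‖ϖ‖^m)` in abc-iut-S7's rescaled norm) have `χ(x) ∉ 𝔪_v^m`.
In words: moved balls are DENSE in the radius scale — every ideal-shaped region `𝔪_v^k` has, within `e(v|p)` steps below it, a
region that print's (Ind1) strip part inflates.  (The `ℚ_p`-ball lemma and the index identity are gen 10's p479901 / p478576;
Jannsen–Wingberg: K. Kondo arXiv:2512.09231 §2, NSW Thm. 7.5.14.)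

HONEST SCOPE as in the parent file: «twist planes realised ⟹ mover»; the realisation is the named Literature fact
`DehnTwistTransvectionsOnUnitsAll` in the sequel.  A statement about OUR typed objects at ONE place; nothing here asserts or
refutes [IUTchIII] Cor. 3.12.  [claim: Mochizuki2012, status: disputed] for every [IUTchIII] quotation;
[cite: NeukirchSchmidtWingberg2008, Thm 7.5.14]; [cite: Kondo2025OuterAutMLF, §2 Thm 2.1 and proof of Thm 2.3 p.10];
[cite: DupuyHilado2025, §4.7].  typed ≠ proved.
-/

set_option autoImplicit false

noncomputable section

open Metric Set
open scoped Pointwise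

namespace Summit.ABC.IUTFork.Thm311.TwistLattice

open Literature.NumberTheory.GaloisRepresentations.Ultrametric Literature.IUT.LogVolume
open Literature.NumberTheory.GaloisRepresentations.Ultrametric.PadicUniformizer

/-! ## 1. Windowed obstruction: no window of `e + 1` consecutive balls is stable under all planes (`f` odd) -/

section Window

variable (p : ℕ) [Fact p.Prime] {K : Type*} [NontriviallyNormedField K] [NormedAlgebra ℚ_[p] K]
  [IsUltrametricDist K] [ProperSpace K]

open scoped NormedField in
/-- **Windowed all-planes parity obstruction.**  Same setting as `not_forall_twistStable_piBall_of_odd` (residue degree `f`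
odd, `[K : ℚ_p] < e + 2·#ι`, `e = absRamificationIdx`, a Kronecker family of twist planes over `ℚ_p`): for EVERY `k ∈ ℤ`, not
all the balls `ϖ^m 𝒪` with `k ≤ m ≤ k + e` are stable under all the transvections `v ↦ v + cb i v • ya i`, `v ↦ v − ca i v • yb i`.
(Count along `B_k ⊋ ⋯ ⊋ B_{k+e}`: per step `[P_m:P_{m+1}]²·p ≤ p^f`, in total `[P_k : P_{k+e}] = p^{#ι}` since the coefficient
balls `{‖r‖·‖ya i‖ ≤ ‖ϖ‖^k}` and `{‖r‖·‖ya i‖ ≤ ‖ϖ‖^{k+e} = ‖p‖·‖ϖ‖^k}` of `ℚ_p` have index `p`; `e·f = [K:ℚ_p]`.)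
[cite: NeukirchSchmidtWingberg2008, Thm 7.5.14] [cite: Kondo2025OuterAutMLF, §2 Thm 2.1 and proof of Thm 2.3 p.10] -/
theorem not_forall_twistStable_piBall_window_of_odd (hf : Odd (residueDegree p K))
    {ι : Type*} [Fintype ι] [DecidableEq ι]
    (hdim : Module.finrank ℚ_[p] K < absRamificationIdx p K + 2 * Fintype.card ι)
    {ϖ : Kˣ} (hϖ : IsUniformizer ϖ) {ca cb : ι → (K →ₗ[ℚ_[p]] ℚ_[p])} {ya yb : ι → K}
    (haa : ∀ i j, ca i (ya j) = if i = j then 1 else 0) (hbb : ∀ i j, cb i (yb j) = if i = j then 1 else 0)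
    (hab : ∀ i j, ca i (yb j) = 0) (hba : ∀ i j, cb i (ya j) = 0) (k : ℤ) :
    ¬ ∀ m : ℤ, k ≤ m → m ≤ k + absRamificationIdx p K → ∀ i,
        (∀ v ∈ (piBall (ϖ ^ m) : OpenAddSubgroup K).toAddSubgroup,
          v + cb i v • ya i ∈ (piBall (ϖ ^ m) : OpenAddSubgroup K).toAddSubgroup) ∧
        (∀ v ∈ (piBall (ϖ ^ m) : OpenAddSubgroup K).toAddSubgroup,
          v - ca i v • yb i ∈ (piBall (ϖ ^ m) : OpenAddSubgroup K).toAddSubgroup) := by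
  intro hall
  have hP : p.Prime := Fact.out
  have hef : absRamificationIdx p K * residueDegree p K = Module.finrank ℚ_[p] K :=
    absRamificationIdx_mul_residueDegree p K
  -- the chain `Λ j = B_{k+j}`, `j ∈ ℕ`
  let Λ : ℕ → AddSubgroup K := fun j => (piBall (ϖ ^ (k + (j : ℤ))) : OpenAddSubgroup K).toAddSubgroup
  have hΛ : ∀ j : ℕ, Λ j = (piBall (ϖ ^ (k + (j : ℤ))) : OpenAddSubgroup K).toAddSubgroup := fun _ => rfl
  have hanti : ∀ j : ℕ, Λ (j + 1) ≤ Λ j := by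
    intro j
    rw [hΛ, hΛ, Nat.cast_succ, ← add_assoc]
    exact piBall_zpow_succ_le hϖ.1.le _
  have hst : ∀ j : ℕ, j ≤ absRamificationIdx p K →
      ∀ i, (∀ v ∈ Λ j, v + cb i v • ya i ∈ Λ j) ∧ (∀ v ∈ Λ j, v - ca i v • yb i ∈ Λ j) := by
    intro j hj
    exact hall (k + (j : ℤ)) (by omega) (by omega)
  have hidx : ∀ j : ℕ, (Λ (j + 1)).relIndex (Λ j) = p ^ residueDegree p K := by
    intro j
    rw [hΛ, hΛ, Nat.cast_succ, ← add_assoc, relIndex_piBall_zpow_succ, hϖ.resIndex_eq_card_residueField,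
      card_residueField p K]
  -- plane coefficient groups `P j = κa(Λ j) ≤ ℚ_p^ι`
  let P : ℕ → AddSubgroup (ι → ℚ_[p]) := fun j => (Λ j).map (LinearMap.pi ca).toAddMonoidHom
  -- per step `j < e`: `[P_j : P_{j+1}]² · p ≤ p^f`
  have hstep : ∀ j < absRamificationIdx p K, ((P (j + 1)).relIndex (P j)) ^ 2 * p ≤ p ^ residueDegree p K := by
    intro j hj
    have h := relIndex_eq_sq_mul haa hbb hab hba (hst j hj.le) (hanti j) (hst (j + 1) hj)
    rw [hidx j] at h
    exact sq_mul_le_pow_of_odd hP hf h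
  -- the plane part in total: `[P_0 : P_e] = p^{#ι}`
  have hPpi : ∀ j : ℕ, j ≤ absRamificationIdx p K → P j = AddSubgroup.pi Set.univ
      (fun i => (Λ j).comap (LinearMap.toSpanSingleton ℚ_[p] K (ya i)).toAddMonoidHom) :=
    fun j hj => map_pi_ca_eq_pi haa hbb (hst j hj)
  have hϖk : 0 < ‖(ϖ : K)‖ ^ k := zpow_pos (norm_pos_iff.mpr ϖ.ne_zero) k
  have hfac : ∀ i, ((Λ (absRamificationIdx p K)).comap (LinearMap.toSpanSingleton ℚ_[p] K (ya i)).toAddMonoidHom).relIndex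
      ((Λ 0).comap (LinearMap.toSpanSingleton ℚ_[p] K (ya i)).toAddMonoidHom) = p := by
    intro i
    have hya0 : ya i ≠ 0 := by
      intro h0
      have h1 := haa i i
      rw [h0, map_zero, if_pos rfl] at h1
      exact zero_ne_one h1
    have hyapos : 0 < ‖ya i‖ := norm_pos_iff.mpr hya0
    refine relIndex_ball_padic p (ρ := ‖(ϖ : K)‖ ^ k / ‖ya i‖) (div_pos hϖk hyapos) (fun r => ?_) (fun r => ?_)
    · rw [AddSubgroup.mem_comap, LinearMap.toAddMonoidHom_coe, LinearMap.toSpanSingleton_apply, hΛ,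
        mem_toAddSubgroup_piBall, Nat.cast_zero, add_zero, Units.val_zpow_eq_zpow_val, norm_zpow, norm_smul,
        ← le_div_iff₀ hyapos]
    · rw [AddSubgroup.mem_comap, LinearMap.toAddMonoidHom_coe, LinearMap.toSpanSingleton_apply, hΛ,
        mem_toAddSubgroup_piBall, zpow_add, zpow_natCast, Units.val_mul, Units.val_pow_eq_pow_val,
        Units.val_zpow_eq_zpow_val, norm_mul, norm_pow, norm_zpow, ← norm_prime_eq_norm_pow p K hϖ,
        norm_natCast_eq_padicNorm p K p, norm_smul, ← le_div_iff₀ hyapos, mul_comm (‖(ϖ : K)‖ ^ k), mul_div_assoc]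
  have hPtot : (P (absRamificationIdx p K)).relIndex (P 0) = p ^ Fintype.card ι := by
    rw [hPpi _ le_rfl, hPpi 0 (Nat.zero_le _), relIndex_pi]
    rw [Finset.prod_congr rfl fun i _ => hfac i, Finset.prod_const, Finset.card_univ]
  have hprod : ∏ j ∈ Finset.range (absRamificationIdx p K), (P (j + 1)).relIndex (P j) = p ^ Fintype.card ι := by
    rw [← relIndex_chain_eq_prod P (absRamificationIdx p K) (fun j _ => AddSubgroup.map_mono (hanti j)), hPtot]
  -- `(p^{#ι})² · p^e ≤ (p^f)^e`
  have hineq : (p ^ Fintype.card ι) ^ 2 * p ^ absRamificationIdx p K ≤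
      (p ^ residueDegree p K) ^ absRamificationIdx p K := by
    calc (p ^ Fintype.card ι) ^ 2 * p ^ absRamificationIdx p K
        = ∏ j ∈ Finset.range (absRamificationIdx p K), (((P (j + 1)).relIndex (P j)) ^ 2 * p) := by
          rw [Finset.prod_mul_distrib, Finset.prod_pow, hprod, Finset.prod_const, Finset.card_range]
      _ ≤ ∏ j ∈ Finset.range (absRamificationIdx p K), p ^ residueDegree p K :=
          Finset.prod_le_prod' fun j hj => hstep j (Finset.mem_range.mp hj)
      _ = (p ^ residueDegree p K) ^ absRamificationIdx p K := by rw [Finset.prod_const, Finset.card_range]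
  rw [← pow_mul, ← pow_add, ← pow_mul, Nat.pow_le_pow_iff_right hP.one_lt, mul_comm (residueDegree p K),
    hef] at hineq
  omega

open scoped NormedField in
/-- **OUTWARD form: in every window of `e + 1` consecutive balls some point of some ball is carried OUT of it.**  Under the
hypotheses of `not_forall_twistStable_piBall_window_of_odd`, for every `k ∈ ℤ` there are `m` with `k ≤ m ≤ k + e`, a plane `i`
and a point `v` with `‖v‖ ≤ ‖ϖ‖^m` such that `‖v + cb i v • ya i‖ > ‖ϖ‖^m` or `‖v − ca i v • yb i‖ > ‖ϖ‖^m` — the twist-hull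
of the ball `B(0,‖ϖ‖^m)` is STRICTLY larger than the ball. [cite: NeukirchSchmidtWingberg2008, Thm 7.5.14]
[cite: Kondo2025OuterAutMLF, §2 Thm 2.1 and proof of Thm 2.3 p.10] -/
theorem exists_transvection_mapsOut_piBall_of_odd (hf : Odd (residueDegree p K))
    {ι : Type*} [Fintype ι] [DecidableEq ι]
    (hdim : Module.finrank ℚ_[p] K < absRamificationIdx p K + 2 * Fintype.card ι)
    {ϖ : Kˣ} (hϖ : IsUniformizer ϖ) {ca cb : ι → (K →ₗ[ℚ_[p]] ℚ_[p])} {ya yb : ι → K}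
    (haa : ∀ i j, ca i (ya j) = if i = j then 1 else 0) (hbb : ∀ i j, cb i (yb j) = if i = j then 1 else 0)
    (hab : ∀ i j, ca i (yb j) = 0) (hba : ∀ i j, cb i (ya j) = 0) (k : ℤ) :
    ∃ m : ℤ, k ≤ m ∧ m ≤ k + absRamificationIdx p K ∧ ∃ i, ∃ v : K, ‖v‖ ≤ ‖(ϖ : K)‖ ^ m ∧
      (‖(ϖ : K)‖ ^ m < ‖v + cb i v • ya i‖ ∨ ‖(ϖ : K)‖ ^ m < ‖v - ca i v • yb i‖) := by
  by_contra hcon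
  push Not at hcon
  apply not_forall_twistStable_piBall_window_of_odd p hf hdim hϖ haa hbb hab hba k
  intro m hkm hmk i
  have hball : ∀ x : K, x ∈ (piBall (ϖ ^ m) : OpenAddSubgroup K).toAddSubgroup ↔ ‖x‖ ≤ ‖(ϖ : K)‖ ^ m := by
    intro x
    rw [mem_toAddSubgroup_piBall, Units.val_zpow_eq_zpow_val, norm_zpow]
  refine ⟨fun v hv => ?_, fun v hv => ?_⟩
  · rw [hball] at hv ⊢
    exact (hcon m hkm hmk i v hv).1
  · rw [hball] at hv ⊢
    exact (hcon m hkm hmk i v hv).2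

end Window

end Summit.ABC.IUTFork.Thm311.TwistLattice

/-! ## 3. At the real log-shell `K_v`: in every window of `e(v|p) + 1` balls one is inflated by print's (Ind1) strip part -/

namespace Summit.ABC.IUTFork.Thm311.Real

open NumberField IsDedekindDomain Literature.NumberTheory.NumberFields Literature.IUT.LogVolume
open Literature.NumberTheory.GaloisRepresentations.Ultrametric Summit.ABC.IUTFork.Thm311.TwistLattice

variable {F : Type} [Field F] [NumberField F] (p : ℕ) [Fact p.Prime] (v : HeightOneSpectrum (𝓞 F))
  (hv : ((p : ℕ) : 𝓞 F) ∈ v.asIdeal)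

/-- **PRINT'S (Ind1) STRIP PART INFLATES A BALL IN EVERY WINDOW OF `e(v|p) + 1` CONSECUTIVE BALLS (`f(v|p)` odd).**  With the
realisation binders of `exists_mem_ind1StripOf_image_closedBall_ne_of_planes` — `ψ i, ψ' i ∈ Real.ind1StripOf v L` acting on
`K_v` (rescaled norm) as the transvection pairs of a Kronecker family of `#ι` twist planes over `ℚ_p`, `f(v|p)` odd,
`e(v|p)·f(v|p) < e(v|p) + 2·#ι` —: for every `k ∈ ℤ` there are `χ ∈ Real.ind1StripOf v L`, `m` with `k ≤ m ≤ k + e(v|p)` and a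
point `x ∈ 𝔪_v^m = B(0,‖ϖ‖^m)` with `χ(x) ∉ 𝔪_v^m`: the (Ind1)-hull of that ideal-shaped region is STRICTLY larger than the
region.  Contrast: print's (Ind2) moves no ball; Dupuy–Hilado's (Ind1) is `{1}`. [claim: Mochizuki2012, status: disputed]
[cite: NeukirchSchmidtWingberg2008, Thm 7.5.14] [cite: DupuyHilado2025, §4.7] -/
theorem exists_mem_ind1StripOf_mapsOut_closedBall_of_planes (hfodd : Odd (v.asIdeal.inertiaDeg ℤ))
    (L : Additive (↥(v.adicCompletionIntegers F))ˣ →+ v.adicCompletion F)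
    {ϖ : (RescaledCompletion F p v hv)ˣ} (hϖ : IsUniformizer ϖ)
    {ι : Type*} [Fintype ι] [DecidableEq ι] (hdim : localDeg F v < v.asIdeal.ramificationIdx ℤ + 2 * Fintype.card ι)
    {ca cb : ι → (RescaledCompletion F p v hv →ₗ[ℚ_[p]] ℚ_[p])} {ya yb : ι → RescaledCompletion F p v hv}
    (haa : ∀ i j, ca i (ya j) = if i = j then 1 else 0) (hbb : ∀ i j, cb i (yb j) = if i = j then 1 else 0)
    (hab : ∀ i j, ca i (yb j) = 0) (hba : ∀ i j, cb i (ya j) = 0)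
    {ψ ψ' : ι → (v.adicCompletion F ≃+ v.adicCompletion F)} (hψ : ∀ i, ψ i ∈ ind1StripOf v L)
    (hψ' : ∀ i, ψ' i ∈ ind1StripOf v L)
    (hT : ∀ i (x : RescaledCompletion F p v hv),
      RescaledCompletion.of F p v hv (ψ i ((RescaledCompletion.of F p v hv).symm x)) = x + cb i x • ya i)
    (hT' : ∀ i (x : RescaledCompletion F p v hv),
      RescaledCompletion.of F p v hv (ψ' i ((RescaledCompletion.of F p v hv).symm x)) = x - ca i x • yb i)
    (k : ℤ) :
    ∃ χ ∈ ind1StripOf v L, ∃ m : ℤ, k ≤ m ∧ m ≤ k + v.asIdeal.ramificationIdx ℤ ∧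
      ∃ x ∈ closedBall (0 : RescaledCompletion F p v hv) (‖(ϖ : RescaledCompletion F p v hv)‖ ^ m),
        RescaledCompletion.of F p v hv (χ ((RescaledCompletion.of F p v hv).symm x)) ∉
          closedBall (0 : RescaledCompletion F p v hv) (‖(ϖ : RescaledCompletion F p v hv)‖ ^ m) := by
  -- `f(K_v) = f(v|p)`, `e(K_v) = e(v|p)`, `[K_v : ℚ_p] = e(v|p) f(v|p)` (abc-iut-S7)
  have hf : Odd (residueDegree p (RescaledCompletion F p v hv)) := by
    rw [residueDegree_rescaledCompletion F p v hv]; exact hfodd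
  have hfin : Module.finrank ℚ_[p] (RescaledCompletion F p v hv) = localDeg F v :=
    (RescaledCompletion.localDeg_eq_finrank F p v hv).symm
  have he : absRamificationIdx p (RescaledCompletion F p v hv) = v.asIdeal.ramificationIdx ℤ :=
    absRamificationIdx_rescaledCompletion F p v hv
  have hd : Module.finrank ℚ_[p] (RescaledCompletion F p v hv) <
      absRamificationIdx p (RescaledCompletion F p v hv) + 2 * Fintype.card ι := by
    rw [he, hfin]; exact hdim
  obtain ⟨m, hkm, hmk, i, x, hx, hout⟩ :=
    exists_transvection_mapsOut_piBall_of_odd p (K := RescaledCompletion F p v hv) hf hd hϖ haa hbb hab hba k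
  rw [he] at hmk
  rcases hout with h | h
  · refine ⟨ψ i, hψ i, m, hkm, hmk, x, mem_closedBall_zero_iff.mpr hx, ?_⟩
    rw [mem_closedBall_zero_iff, hT, not_le]
    exact h
  · refine ⟨ψ' i, hψ' i, m, hkm, hmk, x, mem_closedBall_zero_iff.mpr hx, ?_⟩
    rw [mem_closedBall_zero_iff, hT', not_le]
    exact h

end Summit.ABC.IUTFork.Thm311.Real

end
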